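import Mathlib
import HarnessLib
import Literature.MathematicalPhysics.QuantumLattice.HeisenbergOrderNeelRiemann3
import Summits.HubbardSuperconductivity.HubbardSuperconductivity.Theorems.ChiralWindowCwKLChiralWindowMuWindow
import Summits.HubbardSuperconductivity.HubbardSuperconductivity.Theorems.ChiralWindowCwKLChiralWindowStubKlFillingUpper

/-!
# Crux `CwKLChiralWindow` (stmt-HubbardSuperconductivity-1741), line `Sketch`: stub `stub_klFillingLower`

For the nearest-neighbour band `ε₀ = squareDispersion 1 0` (`ε₀ p = -2 (cos p₀ + cos p₁)`) the
filling is `n(μ) = 2 vol({ε₀ < μ} ∩ BZ) / (2π)²` (`kl_mu_filling_eq`).  We prove the coarse lower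
filling inequality `13/25 ≤ n(-111/100)` (enclosure hypothesis E0, lower end) by an inscribed disc:

* the sixth-order Taylor minorant `1 - x²/2 + x⁴/24 - x⁶/720 ≤ cos x` (the tree's
  `KLSNumerics.taylor_six_le_cos`, applied to `|x|`) turns
  `cos x + cos y > 111/200` on the disc `x² + y² < r²`, `r = 363/200`, into a polynomial inequality in
  `(a, b) = (x², y²)` on the triangle `a, b ≥ 0`, `a + b < r²` (`klL_poly`: with `s = a + b` the
  polynomial is `2 - s/2 + s²/48 - s³/2880 + (a - b)² (1/48 - s/960)`, decreasing in `s ≤ r²` and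
  `≥ 0.5665 > 0.555` at `s = r²`);
* hence `B(0, r) ⊆ {ε₀ < -111/100} ∩ BZ` (`r < π`; `klL_ball_subset_occupied`), so
  `vol({ε₀ < -111/100} ∩ BZ) ≥ π r²` and `n(-111/100) ≥ r²/(2π) ≥ 13/25` (`r² = 3.294`, `π < 3.15`).

(The true values: `n(-111/100) = 0.586`, and the largest inscribed disc has `r = √2·arccos(111/400)
= 1.8238`.)  Folklore; no definitions.
-/

set_option linter.dupNamespace false

namespace Summit.HubbardSuperconductivity.HubbardSuperconductivity.Theorems

open MeasureTheory Literature.MathematicalPhysics.QuantumLattice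

/-! ### The polynomial core and the cosine minorant -/

/-- The polynomial core: for `a, b ≥ 0` with `a + b < r²`, `r = 363/200`,
`111/200 < 2 - (a+b)/2 + (a²+b²)/24 - (a³+b³)/720`.  With `s = a + b` the right-hand side is
`g s + (a - b)² (1/48 - s/960)` where `g s = 2 - s/2 + s²/48 - s³/2880` is decreasing on `[0, r²]`
(`g s - g R = (R - s) (1/2 - (s+R)/48 + (s² + sR + R²)/2880)`) and `g (r²) > 0.5665`. [folklore] -/
theorem klL_poly {a b : ℝ} (ha : 0 ≤ a) (hb : 0 ≤ b) (hab : a + b < (363 / 200) ^ 2) :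
    111 / 200 < 2 - (a + b) / 2 + (a ^ 2 + b ^ 2) / 24 - (a ^ 3 + b ^ 3) / 720 := by
  set R : ℝ := (363 / 200) ^ 2 with hR
  set s : ℝ := a + b with hs
  have hs0 : 0 ≤ s := add_nonneg ha hb
  have hsR : s ≤ R := hab.le
  have hR' : R = 131769 / 40000 := by rw [hR]; norm_num
  have hid : 2 - (a + b) / 2 + (a ^ 2 + b ^ 2) / 24 - (a ^ 3 + b ^ 3) / 720 =
      (2 - s / 2 + s ^ 2 / 48 - s ^ 3 / 2880) + (a - b) ^ 2 * (1 / 48 - s / 960) := by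
    rw [hs]; ring
  have h1 : 0 ≤ (a - b) ^ 2 * (1 / 48 - s / 960) :=
    mul_nonneg (sq_nonneg _) (by rw [hR'] at hsR; linarith)
  -- `g` is decreasing on `[0, R]`: `g s - g R = (R - s) · (positive bracket)`
  have hbr : 0 ≤ 1 / 2 - (s + R) / 48 + (s ^ 2 + s * R + R ^ 2) / 2880 := by
    rw [hR'] at hsR ⊢
    nlinarith [sq_nonneg s, mul_nonneg hs0 hs0]
  have hgd : (2 - s / 2 + s ^ 2 / 48 - s ^ 3 / 2880) - (2 - R / 2 + R ^ 2 / 48 - R ^ 3 / 2880) =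
      (R - s) * (1 / 2 - (s + R) / 48 + (s ^ 2 + s * R + R ^ 2) / 2880) := by ring
  have hg : 2 - R / 2 + R ^ 2 / 48 - R ^ 3 / 2880 ≤ 2 - s / 2 + s ^ 2 / 48 - s ^ 3 / 2880 := by
    have := mul_nonneg (sub_nonneg.2 hsR) hbr
    linarith
  have hgR : (111 / 200 : ℝ) < 2 - R / 2 + R ^ 2 / 48 - R ^ 3 / 2880 := by
    rw [hR']; norm_num
  linarith

/-- On the disc `x² + y² < (363/200)²` one has `cos x + cos y > 111/200` (the sixth-order minorants
`1 - t²/2 + t⁴/24 - t⁶/720 ≤ cos t` at `t = |x|, |y|`, i.e. the tree's `KLSNumerics.taylor_six_le_cos`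
and evenness, then `klL_poly` with `(a, b) = (x², y²)`). [folklore] -/
theorem klL_cos_add_cos_gt {x y : ℝ} (h : x ^ 2 + y ^ 2 < (363 / 200) ^ 2) :
    111 / 200 < Real.cos x + Real.cos y := by
  have hx := KLSNumerics.taylor_six_le_cos (abs_nonneg x)
  have hy := KLSNumerics.taylor_six_le_cos (abs_nonneg y)
  rw [Real.cos_abs, Even.pow_abs (by decide : Even 2), Even.pow_abs (by decide : Even 4),
    Even.pow_abs (by decide : Even 6)] at hx hy
  have hp := klL_poly (sq_nonneg x) (sq_nonneg y) h
  have ex4 : (x ^ 2) ^ 2 = x ^ 4 := by ring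
  have ex6 : (x ^ 2) ^ 3 = x ^ 6 := by ring
  have ey4 : (y ^ 2) ^ 2 = y ^ 4 := by ring
  have ey6 : (y ^ 2) ^ 3 = y ^ 6 := by ring
  rw [ex4, ex6, ey4, ey6] at hp
  linarith

/-! ### Disc containment and the stub -/

/-- The disc of radius `363/200` lies in the Brillouin zone and strictly below the energy `-111/100`:
there `cos p₀ + cos p₁ > 111/200` (`klL_cos_add_cos_gt`) and `|pᵢ| < 363/200 < π`. [folklore] -/
theorem klL_ball_subset_occupied :
    Metric.ball (0 : Momentum) (363 / 200) ⊆
      {p : Momentum | squareDispersion 1 0 p < -111 / 100} ∩ brillouinZone := by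
  intro p hp
  rw [EuclideanSpace.ball_zero_eq _ (by norm_num), Set.mem_setOf_eq, Fin.sum_univ_two] at hp
  refine ⟨?_, ?_⟩
  · simp only [Set.mem_setOf_eq, squareDispersion, mul_zero, zero_mul, sub_zero, mul_one]
    have := klL_cos_add_cos_gt hp
    linarith
  · show ∀ i, p i ∈ Set.Ico (-Real.pi) Real.pi
    have hpi := Real.pi_gt_three
    have key : ∀ x : ℝ, x ^ 2 < Real.pi ^ 2 → x ∈ Set.Ico (-Real.pi) Real.pi := fun x hx => by
      have := abs_lt_of_sq_lt_sq' hx Real.pi_pos.le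
      exact ⟨this.1.le, this.2⟩
    refine Fin.forall_fin_two.2 ⟨key _ ?_, key _ ?_⟩
    · nlinarith [sq_nonneg (p 1)]
    · nlinarith [sq_nonneg (p 0)]

/-- **Stub `stub_klFillingLower`** (E0, lower end): at `μ = -111/100` the free-band filling is at
least `13/25`: the disc of radius `r = 363/200` lies in the Fermi sea `{cos x + cos y > 111/200}`,
so `n(-111/100) ≥ 2 π r² / (2π)² = r²/(2π) ≥ 13/25` (`r² = 3.294`, `π < 3.15`). [folklore] -/
theorem stub_klFillingLower :
    (13 / 25 : ℝ) ≤ KohnLuttinger.filling (squareDispersion 1 0) (-111 / 100) := by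
  rw [kl_mu_filling_eq]
  have hV : (363 / 200) ^ 2 * Real.pi ≤ (volume ({p : Momentum |
      squareDispersion 1 0 p < -111 / 100} ∩ brillouinZone)).toReal := by
    have h1 : volume (Metric.ball (0 : Momentum) (363 / 200)) ≤ volume ({p : Momentum |
        squareDispersion 1 0 p < -111 / 100} ∩ brillouinZone) :=
      measure_mono klL_ball_subset_occupied
    have h2 : (volume (Metric.ball (0 : Momentum) (363 / 200))).toReal =
        (363 / 200) ^ 2 * Real.pi := by
      rw [EuclideanSpace.volume_ball_fin_two, ENNReal.toReal_mul, ENNReal.toReal_pow,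
        ENNReal.toReal_ofReal (by norm_num), ENNReal.toReal_ofReal Real.pi_pos.le]
    rw [← h2]
    exact ENNReal.toReal_mono (kl_mu_volume_occupied_lt_top _).ne h1
  have hpi := Real.pi_lt_d2
  have hpi0 := Real.pi_pos
  rw [le_div_iff₀ (by positivity)]
  nlinarith [mul_nonneg hpi0.le (sub_nonneg.2 hpi.le)]

end Summit.HubbardSuperconductivity.HubbardSuperconductivity.Theorems
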